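import Summits.ABC.IUTFork.Cor312StatementBridges
import HarnessLib

/-!
# [IUTchIII] Cor. 3.12, Steps (xi-d)–(xi-e) over the REAL verbatim setting: the six observations read, the two nodes held (Team A, row A-3)

Cor. 3.12 crew, TEAM A «direct III§3» (human ruling D-0067; plan/C312-TEAMS.md row A-3), seat abc-iut-c312-4 (A4).
TAKES NO SIDE on [IUTchIII] Cor. 3.12. The proof of Cor. 3.12 ([IUTchIII], kurims `paper:url-4b091feeb646`, Step
(xi-d) p. 183 l. 2–42, Step (xi-e) p. 183 l. 43 – p. 184 l. 18) draws at (xi-d) the observations `displayXId`,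
`comparableObjects`, `degreesAsLogVolumes`, `oneColumnLogKummerRectifies` and at (xi-e) `sheMeansFixedValue`,
`displayXIe` (c312-2's `Cor312Proof.Obs`, `Step.xi_d` / `Step.xi_e` with their cited loci and used observations read
on the page). THIS FILE gives each of the six a READING over the FROZEN verbatim setting `P : Cor312.Setting S`
(c312-7 `Cor312Statement.lean`) and proves the two nodes `Step.xi_d.Holds` / `Step.xi_e.Holds` for every reading
`O` of the proof that agrees with these on the six observations:

* (xi-d) `displayXId` ↦ `DisplayXIdReal` — "followed by formation of the holomorphic hull … expressed entirely
  relative to localizations of arithmetic vector bundles over rings … in the 1-column": every union of possible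
  images at a label `j ∈ 𝔽_l^⋇` ADMITS its hull (`HullDefined`), so `^{1,∘}𝒰_{j,v_ℚ}` is a hull-set `λ·𝒪` of the
  1-column frame, an admissible region; `comparableObjects` ↦ `ComparableObjectsReal` — "`ℝ_{≤−|log(Θ)|} ⊆ ℝ;
  −|log(q)| ∈ ℝ`": the two real numbers are FORMED, `−|log(Θ)| ∈ ℝ` (`≠ ⊤`) and `−|log(q)| < 0`;
  `degreesAsLogVolumes` ↦ `DegreesAsLogVolumesReal` — "global arithmetic degrees … may be interpreted as
  log-volumes": `−|log(q)| = −d` for a positive degree `d` (provenance: c312-8 `Cor312Prov.IsSettingOf` pins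
  `d = |log(q)|` of the initial Θ-data; place-wise `log μ_v(q·O_v) = −[F:ℚ]·deg q`, `LanaQPilotVolume`);
  `oneColumnLogKummerRectifies` ↦ `OneColumnLogKummerReal` — the vertical shift is rectified by passing to the
  union over `m ∈ ℤ` ((Ind3)): every possible image is an (Ind1)(Ind2)-translate of `⋃_m` (Kummer image at `(n,m)`)
  — which is how the frozen setting DEFINES `possibleImages` (a theorem by `rfl`-unfolding; the mathematical
  content, upper semi-compatibility, is c312-1's `Column` / L6-t4 Prop. 3.5 (ii), not re-typed here);
* (xi-e) `sheMeansFixedValue` ↦ `SheMeansFixedValueReal` — "(SHE) … expressibility via operations that are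
  valid/executable/well-defined even when subject to the condition that the pilot-object log-volume … be equal to
  the fixed value `−|log(q)|`": `−|log(Θ)|` is computed by operations that DO NOT READ the `q`-pilot — two settings
  over the same situation with the same column, frames and Θ-pilot regions have the same `−|log(Θ)|`, whatever their
  `q`-data (`negLogTheta_congr`, PROVED); `displayXIe` ↦ `DisplayXIeReal` — "yields … `ℝ_{≤−|log(Θ)|} ⊆ ℝ` that
  are linked/related [cf. (IPL)], via isomorphisms of `F^{⊩▶}`-prime-strips, to … `−|log(q)| ∈ ℝ` [cf. (SHE)]": at
  the typed level the NON-VACUOUS content is that both quantities are read, as one c312-2 `Volumes`, by the SAME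
  log-volume of the SAME 1-column container (`toVolumes`); the "∃ isomorphism" reading of "linked/related" is
  vacuous (c312-2 `displayXIe_of_abstractLink_reading`, LANA Rem. 8.2.1) and is NOT used; what "related" must
  deliver beyond this is exactly (xi-f)'s disputed sentence (row A-4's `GapA`), not (xi-e).

RESULTS. `stepXIe_holds` — node (xi-e) HOLDS outright for every agreeing reading (its non-trivial conclusion is a
theorem). `stepXId_holds_of` — node (xi-d) HOLDS for every agreeing reading GIVEN the two finiteness/positivity
clauses `ThetaFinite`, `AbsLogQPos` (the apex hypotheses `hreal`/`hqreal`; the author's justification is the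
opening ¶ p. 175 l. 2–8 "one concludes easily from the [easily verified] compactness …" = row A-0), and
`thetaFinite_of_stepXId` — they are NECESSARY: (xi-d)'s own conclusion `comparableObjects` contains "`−|log(Θ)| ∈
ℝ`". So at (xi-d)/(xi-e) the kernel content is: constructions + `−|log(Θ)|`'s independence from the `q`-side; no
inequality is produced here (c312-2 `realEdges_needed`). [claim: Mochizuki2012, status: disputed] for every
quotation; the theorems are bookkeeping over frozen definitions. NOT here: (xi-f) (row A-4), any judgement.
-/

noncomputable section

namespace Summit.ABC.IUTFork.Cor312

open Thm311 Cor312Proof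

namespace Setting

variable {T : ThetaIndex} {S : Situation T} (P : Setting S)

/-! ## 1. (xi-d): the four observations over the verbatim setting -/

/-- **(xi-d) display, read over the setting** (p. 183 l. 3–10: "followed by formation of the holomorphic hull …
expressed entirely relative to localizations of arithmetic vector bundles over rings that arise in the arithmetic
holomorphic structure in the 1-column [cf. (SHE)]"): at every label `j ∈ 𝔽_l^⋇` and every `v_ℚ` the union of the
possible images admits its holomorphic hull (relatively compact and non-degenerate), so that `^{1,∘}𝒰_{j,v_ℚ}` is a
hull-set `λ·𝒪` of the 1-column frame. [claim: Mochizuki2012, status: disputed] -/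
@[claim "Mochizuki2012" "disputed"]
def DisplayXIdReal : Prop := ∀ (i : Fin T.lstar) (vQ : T.VQ), P.HullDefined (labelSucc i) vQ

/-- Under the (xi-d) display reading, `^{1,∘}𝒰_{j,v_ℚ}` IS a hull-set ("arithmetic vector bundle over the 1-column
ring"). [claim: Mochizuki2012, status: disputed] -/
theorem thetaHull_mem_hul_of_displayXIdReal (h : P.DisplayXIdReal) (i : Fin T.lstar) (vQ : T.VQ) :
    P.thetaHull (labelSucc i) vQ ∈ (P.frame (labelSucc i) vQ).Hul :=
  (P.frame (labelSucc i) vQ).hull_mem_of_hasHull (h i vQ).1 (h i vQ).2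

/-- … hence an admissible region of Thm. 3.11 (i) (a) (its log-volume is read, not a junk value).
[claim: Mochizuki2012, status: disputed] -/
theorem thetaHull_adm_of_displayXIdReal (h : P.DisplayXIdReal) (i : Fin T.lstar) (vQ : T.VQ) :
    (S.D P.n).Adm (labelSucc i) vQ (P.thetaHull (labelSucc i) vQ) :=
  P.thetaHull_adm (h i vQ)

/-- The local contribution `thetaLocal` is a real number iff the hull is defined. [folklore] -/
theorem thetaLocal_ne_top_iff (j : T.Label) (vQ : T.VQ) : P.thetaLocal j vQ ≠ ⊤ ↔ P.HullDefined j vQ := by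
  unfold thetaLocal
  split_ifs with h
  · simp [h]
  · simp [h]

/-- The (xi-d) display reading IS the first clause of `ThetaFinite` ("`thetaLocal ≠ ⊤` at every label in
`𝔽_l^⋇`"). [folklore] -/
theorem displayXIdReal_iff : P.DisplayXIdReal ↔ ∀ (i : Fin T.lstar) (vQ : T.VQ), P.thetaLocal (labelSucc i) vQ ≠ ⊤ := by
  simp only [DisplayXIdReal, thetaLocal_ne_top_iff]

/-- In particular `ThetaFinite` yields the (xi-d) display reading. [folklore] -/
theorem displayXIdReal_of_thetaFinite (h : P.ThetaFinite) : P.DisplayXIdReal :=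
  P.displayXIdReal_iff.mpr h.1

/-- `−|log(Θ)| ≠ +∞` iff `ThetaFinite` (unfolding of c312-7's `negLogTheta`). [folklore] -/
theorem negLogTheta_ne_top_iff : P.negLogTheta ≠ ⊤ ↔ P.ThetaFinite := by
  unfold negLogTheta
  split_ifs with h
  · simp [h]
  · simp [h]

/-- **(xi-d) "comparable objects", read over the setting** (p. 183 l. 14–24: "we are able to obtain completely
comparable objects …, namely, `ℝ_{≤−|log(Θ)|} := {λ ∈ ℝ | λ ≤ −|log(Θ)|} ⊆ ℝ; −|log(q)| ∈ ℝ`"): the two real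
numbers are FORMED — `−|log(Θ)| ∈ ℝ` (not `+∞`) and `−|log(q)| ∈ ℝ` with `|log(q)| > 0`.
[claim: Mochizuki2012, status: disputed] -/
@[claim "Mochizuki2012" "disputed"]
def ComparableObjectsReal : Prop := P.negLogTheta ≠ ⊤ ∧ P.AbsLogQPos

/-- The comparable-objects reading is `ThetaFinite ∧ AbsLogQPos` — the two finiteness/positivity clauses of the
Corollary's statement. [folklore] -/
theorem comparableObjectsReal_iff : P.ComparableObjectsReal ↔ P.ThetaFinite ∧ P.AbsLogQPos := by
  rw [ComparableObjectsReal, negLogTheta_ne_top_iff]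

/-- Under it the two quantities form ONE c312-2 `Volumes` with finite `−|log(Θ)|` (the "comparable objects").
[folklore] -/
theorem toVolumes_finite (h : P.ComparableObjectsReal) : (P.toVolumes h.2).Finite := h.1

/-- **(xi-d) "degrees as log-volumes", read over the setting** (p. 183 l. 28–32: "global arithmetic degrees of
objects of global realified Frobenioids may be interpreted as log-volumes"): the `q`-pilot log-volume `−|log(q)|` IS
minus a positive arithmetic degree `d` (provenance: c312-8 `Cor312Prov.IsSettingOf` pins `d = |log(q)|` computed from
the `q`-parameters of `E_F`; place-wise `log μ_v(q·O_v) = −[F:ℚ]·deg(q)`, `LanaQPilotVolume`).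
[claim: Mochizuki2012, status: disputed] -/
@[claim "Mochizuki2012" "disputed"]
def DegreesAsLogVolumesReal : Prop := ∃ d : ℝ, 0 < d ∧ P.negLogQ = -d

/-- At the typed level the degree reading of `−|log(q)|` is equivalent to `|log(q)| > 0` (`AbsLogQPos`): the
degree is `d = |log(q)|`. [folklore] -/
theorem degreesAsLogVolumesReal_iff : P.DegreesAsLogVolumesReal ↔ P.AbsLogQPos := by
  constructor
  · rintro ⟨d, hd, h⟩
    change P.negLogQ < 0
    rw [h]; linarith
  · intro h
    exact ⟨-P.negLogQ, by change P.negLogQ < 0 at h; linarith, by ring⟩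

/-- **(xi-d) "the 1-column log-Kummer correspondence rectifies the vertical shift", read over the setting**
(p. 183 l. 32–42): every possible image of the Θ-pilot object is an (Ind1)(Ind2)-translate of the UNION over the
vertical positions `m ∈ ℤ` of its Kummer images at `(n, m)` — i.e. the shift is absorbed by (Ind3), exactly as the
frozen setting defines `possibleImages` (the quantitative content — upper semi-compatibility, Thm. 3.11 (ii)(b)(c)
— is c312-1's `Column` / L6-t4 Prop. 3.5 (ii), not re-typed here). [claim: Mochizuki2012, status: disputed] -/
@[claim "Mochizuki2012" "disputed"]
def OneColumnLogKummerReal : Prop :=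
  ∀ (j : T.Label) (vQ : T.VQ), ∀ U ∈ P.possibleImages j vQ,
    ∃ Φ ∈ indGroup S, U = Φ j vQ '' ⋃ m : ℤ, P.thetaRegion m j vQ

/-- The 1-column log-Kummer reading HOLDS for the frozen setting (by the definition of the possible images).
[folklore] -/
theorem oneColumnLogKummerReal_holds : P.OneColumnLogKummerReal := fun _ _ _ hU => hU

/-! ## 2. (xi-e): (SHE) as independence of `−|log(Θ)|` from the `q`-side, and the display -/

section Congr

variable {P} {P' : Setting S}

/-- Settings with the same Θ-pilot regions have the same (Ind3)-enlarged regions. [folklore] -/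
theorem thetaRegion3_congr (h : P'.thetaRegion = P.thetaRegion) : P'.thetaRegion3 = P.thetaRegion3 := by
  funext j vQ
  unfold thetaRegion3
  rw [h]

/-- … the same possible images. [folklore] -/
theorem possibleImages_congr (h : P'.thetaRegion = P.thetaRegion) : P'.possibleImages = P.possibleImages := by
  funext j vQ
  unfold possibleImages
  rw [thetaRegion3_congr h]

/-- … the same hulls, given the same frames. [folklore] -/
theorem thetaHull_congr (hf : P'.frame = P.frame) (h : P'.thetaRegion = P.thetaRegion) :
    P'.thetaHull = P.thetaHull := by
  funext j vQ
  unfold thetaHull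
  rw [possibleImages_congr h, hf]

/-- … the same hull-definedness. [folklore] -/
theorem hullDefined_congr (hf : P'.frame = P.frame) (h : P'.thetaRegion = P.thetaRegion) (j : T.Label) (vQ : T.VQ) :
    P'.HullDefined j vQ ↔ P.HullDefined j vQ := by
  unfold HullDefined
  rw [possibleImages_congr h, hf]

/-- … the same local contributions, given also the same column `n`. [folklore] -/
theorem thetaLocal_congr (hn : P'.n = P.n) (hf : P'.frame = P.frame) (h : P'.thetaRegion = P.thetaRegion) :
    P'.thetaLocal = P.thetaLocal := by
  funext j vQ
  unfold thetaLocal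
  by_cases hP : P.HullDefined j vQ
  · rw [if_pos hP, if_pos ((hullDefined_congr hf h j vQ).mpr hP), thetaHull_congr hf h, hn]
  · rw [if_neg hP, if_neg (fun h' => hP ((hullDefined_congr hf h j vQ).mp h'))]

/-- … the same `ThetaFinite`. [folklore] -/
theorem thetaFinite_congr (hn : P'.n = P.n) (hf : P'.frame = P.frame) (h : P'.thetaRegion = P.thetaRegion) :
    P'.ThetaFinite ↔ P.ThetaFinite := by
  unfold ThetaFinite
  rw [thetaLocal_congr hn hf h]

/-- **`−|log(Θ)|` does not read the `q`-pilot**: two settings over the same situation with the same column,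
frames and Θ-pilot regions have the same `−|log(Θ)|`, whatever their `q`-data (and whatever else they carry).
[folklore] -/
theorem negLogTheta_congr (hn : P'.n = P.n) (hf : P'.frame = P.frame) (h : P'.thetaRegion = P.thetaRegion) :
    P'.negLogTheta = P.negLogTheta := by
  unfold negLogTheta
  by_cases hP : P.ThetaFinite
  · rw [if_pos hP, if_pos ((thetaFinite_congr hn hf h).mpr hP), thetaLocal_congr hn hf h]
  · rw [if_neg hP, if_neg (fun h' => hP ((thetaFinite_congr hn hf h).mp h'))]

end Congr

/-- **(xi-e) "(SHE) means: even when the pilot-object log-volume is fixed", read over the setting** (p. 183 l. 43 –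
p. 184 l. 9: "expressibility via operations that are valid/executable/well-defined even when subject to the
condition that the pilot-object log-volume associated to the input data … be equal to the fixed value
`−|log(q)| ∈ ℝ`"): the operations producing `ℝ_{≤−|log(Θ)|}` do not read the `q`-pilot — every setting with the
same column, frames and Θ-pilot regions yields the same `−|log(Θ)|`. [claim: Mochizuki2012, status: disputed] -/
@[claim "Mochizuki2012" "disputed"]
def SheMeansFixedValueReal : Prop :=
  ∀ P' : Setting S, P'.n = P.n → P'.frame = P.frame → P'.thetaRegion = P.thetaRegion →
    P'.negLogTheta = P.negLogTheta

/-- The (SHE) reading HOLDS for the frozen setting (`negLogTheta_congr`). [folklore] -/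
theorem sheMeansFixedValueReal_holds : P.SheMeansFixedValueReal := fun _ hn hf h => negLogTheta_congr hn hf h

/-- **(xi-e) display, read over the setting** (p. 184 l. 11–18: "yields a collection of possible log-volumes …
`ℝ_{≤−|log(Θ)|} ⊆ ℝ` that are linked/related [cf. (IPL)], via isomorphisms of `F^{⊩▶}`-prime-strips, to the
pilot-object log-volume `−|log(q)| ∈ ℝ` … [cf. (SHE)]"): the typed, NON-VACUOUS content beyond (xi-d) is that
both quantities are read by the same log-volume of the same 1-column container and so form one pair of comparable
real data (c312-2 `Volumes`, `toVolumes`); the "∃ isomorphism of strips" reading of "linked/related" is vacuous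
(`Cor312Proof.displayXIe_of_abstractLink_reading`, LANA Rem. 8.2.1) and deliberately NOT adopted; anything
stronger is (xi-f)'s sentence (row A-4), not (xi-e). [claim: Mochizuki2012, status: disputed] -/
@[claim "Mochizuki2012" "disputed"]
def DisplayXIeReal : Prop := P.ComparableObjectsReal ∧ P.SheMeansFixedValueReal

/-- The (xi-e) display reading follows from (xi-d)'s comparable objects (the (SHE) part being a theorem).
[folklore] -/
theorem displayXIeReal_of_comparableObjectsReal (h : P.ComparableObjectsReal) : P.DisplayXIeReal :=
  ⟨h, P.sheMeansFixedValueReal_holds⟩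

/-! ## 3. The two nodes -/

/-- A reading `O` of the proof's observations AGREES with this file's real readings on the six observations of
(xi-d)/(xi-e). [folklore] -/
structure AgreesXIde (O : Obs → Prop) : Prop where
  /-- (xi-d) display -/
  displayXId : O .displayXId ↔ P.DisplayXIdReal
  /-- (xi-d) comparable objects -/
  comparableObjects : O .comparableObjects ↔ P.ComparableObjectsReal
  /-- (xi-d) degrees as log-volumes -/
  degreesAsLogVolumes : O .degreesAsLogVolumes ↔ P.DegreesAsLogVolumesReal
  /-- (xi-d) 1-column log-Kummer -/
  oneColumnLogKummerRectifies : O .oneColumnLogKummerRectifies ↔ P.OneColumnLogKummerReal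
  /-- (xi-e) (SHE) -/
  sheMeansFixedValue : O .sheMeansFixedValue ↔ P.SheMeansFixedValueReal
  /-- (xi-e) display -/
  displayXIe : O .displayXIe ↔ P.DisplayXIeReal

variable {P}

/-- **Node (xi-d) HOLDS for every agreeing reading, GIVEN the two clauses `ThetaFinite` and `AbsLogQPos`** (for any
loci reading `L`; the cited loci and the used observations of (xi-c) are not even needed: the node's conclusions are
constructions). [claim: Mochizuki2012, status: disputed] -/
theorem stepXId_holds_of {O : Obs → Prop} (hO : P.AgreesXIde O) (hfin : P.ThetaFinite) (hq : P.AbsLogQPos)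
    (L : Locus → Prop) : Step.xi_d.Holds L O := by
  intro _ _ o ho
  have ho' : o = .displayXId ∨ o = .comparableObjects ∨ o = .degreesAsLogVolumes ∨
      o = .oneColumnLogKummerRectifies := by
    simpa [Step.concl, Step.data] using ho
  rcases ho' with rfl | rfl | rfl | rfl
  · exact hO.displayXId.mpr (P.displayXIdReal_of_thetaFinite hfin)
  · exact hO.comparableObjects.mpr (P.comparableObjectsReal_iff.mpr ⟨hfin, hq⟩)
  · exact hO.degreesAsLogVolumes.mpr (P.degreesAsLogVolumesReal_iff.mpr hq)
  · exact hO.oneColumnLogKummerRectifies.mpr P.oneColumnLogKummerReal_holds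

/-- **The two clauses are NECESSARY at (xi-d)**: if the node's conclusion `comparableObjects` is granted under an
agreeing reading, then `ThetaFinite` and `AbsLogQPos` hold — "`−|log(Θ)| ∈ ℝ`" enters the argument here (its printed
source is the opening paragraph's compactness remark, p. 175 l. 2–8; row A-0). [folklore] -/
theorem thetaFinite_of_comparableObjects {O : Obs → Prop} (hO : P.AgreesXIde O) (h : O .comparableObjects) :
    P.ThetaFinite ∧ P.AbsLogQPos :=
  P.comparableObjectsReal_iff.mp (hO.comparableObjects.mp h)

/-- **Node (xi-e) HOLDS for every agreeing reading, outright** (any `L`): its premise `comparableObjects` (used from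
(xi-d)) gives the display, and the (SHE) reading is a theorem. [claim: Mochizuki2012, status: disputed] -/
theorem stepXIe_holds {O : Obs → Prop} (hO : P.AgreesXIde O) (L : Locus → Prop) : Step.xi_e.Holds L O := by
  intro _ huse o ho
  have hco : O .comparableObjects := huse _ (by simp [Step.uses, Step.data])
  have ho' : o = .sheMeansFixedValue ∨ o = .displayXIe := by simpa [Step.concl, Step.data] using ho
  rcases ho' with rfl | rfl
  · exact hO.sheMeansFixedValue.mpr P.sheMeansFixedValueReal_holds
  · exact hO.displayXIe.mpr (P.displayXIeReal_of_comparableObjectsReal (hO.comparableObjects.mp hco))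

/-- The canonical agreeing reading: take the six real readings themselves (other observations arbitrary, here as
given by `O₀`). [folklore] -/
def realReadingXIde (O₀ : Obs → Prop) : Obs → Prop
  | .displayXId => P.DisplayXIdReal
  | .comparableObjects => P.ComparableObjectsReal
  | .degreesAsLogVolumes => P.DegreesAsLogVolumesReal
  | .oneColumnLogKummerRectifies => P.OneColumnLogKummerReal
  | .sheMeansFixedValue => P.SheMeansFixedValueReal
  | .displayXIe => P.DisplayXIeReal
  | o => O₀ o

/-- `realReadingXIde` agrees with the real readings. [folklore] -/
theorem agreesXIde_realReadingXIde (O₀ : Obs → Prop) : P.AgreesXIde (P.realReadingXIde O₀) :=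
  ⟨Iff.rfl, Iff.rfl, Iff.rfl, Iff.rfl, Iff.rfl, Iff.rfl⟩

/-- **What (xi-d)/(xi-e) do NOT deliver**: the six readings hold for a setting (`ThetaFinite`, `AbsLogQPos`
granted) while NO inequality between `−|log(q)|` and `−|log(Θ)|` is produced at these nodes — the comparable pair
`(−|log(Θ)|, −|log(q)|) = (−2, −1)` of c312-2's `realEdges_needed` is finite with negative `q`-volume and violates
`Cor312`. The edge is (xi-f)'s (row A-4). [folklore] -/
theorem xi_de_produce_no_inequality :
    ∃ V : Volumes, V.Finite ∧ V.negAbsLogq < 0 ∧ ¬ V.Cor312 :=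
  ⟨⟨((-2 : ℝ) : WithTop ℝ), -1, by norm_num⟩, WithTop.coe_ne_top, by norm_num, fun h => by
    have h2 := h.2
    rw [WithTop.coe_le_coe] at h2
    norm_num at h2⟩

end Setting

end Summit.ABC.IUTFork.Cor312

end
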